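import Mathlib
import Literature.NumberTheory.GaloisRepresentations.CubicResidueSymbol
import Summits.Langlands.Langlands.Theses.PicardMuOrdinary

/-!
# Branch-point congruence for the Picard trace (route PicardMuOrdinary, item stmt-Langlands-13761)

For `K = ℚ(ω)`, every `ζ ∈ 𝓞 K` with `ζ² + ζ + 1 = 0`, every `f ∈ ℤ[X]` and every finite place
`𝔭 ∤ 3` of `K` with `f ≢ 0 (mod 𝔭)`:

  `a_𝔭(f) ≡ #{x ∈ 𝓞 K ⧸ 𝔭 : f̄(x) = 0} − 1 (mod 1 − ζ)`,

where `a_𝔭(f) = Literature.NumberTheory.GaloisRepresentations.picardTrace f 𝔭 = −Σ_x χ_𝔭(f̄(x))`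
(cubic residue symbol). This is the elementary shadow of "`J(C)[1 − ω]` is the branch-point
(reflection) module" for the Picard curve `C : y³ = f(x)`, and pins the sign convention of `a_𝔭`
used throughout the route.

Proof: a root `ζ` of `X² + X + 1` is a primitive cube root of unity
(`isPrimitiveRoot_of_sq_add_self_add_one`), and the congruence is the Literature theorem
`picardTrace_sub_card_roots_sub_one_mem_span` (each value of `χ_𝔭` is `0` or a cube root of unity,
hence `≡ 0` or `≡ 1 (mod 1 − ζ)`, and `χ_𝔭(f̄(x)) = 0 ↔ f̄(x) = 0` for `𝔭 ∤ 3`).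

References: Ireland–Rosen, *A Classical Introduction to Modern Number Theory* (1982), Ch. 9 §3;
Upton (2009); Bouw et al. (2020).
-/

set_option linter.dupNamespace false -- project-wide option (lakefile weak.linter.dupNamespace); `Summit.Langlands.Langlands` is the mandated namespace

open Literature.NumberTheory.GaloisRepresentations

namespace Summit.Langlands.Langlands.Theorems

/-- **Branch-point congruence** (item `stmt-Langlands-13761`, route `PicardMuOrdinary`): for every
`ζ ∈ 𝓞 ℚ(ω)` with `ζ² + ζ + 1 = 0`, every `f ∈ ℤ[X]` and every finite `𝔭 ∤ 3` with `f ≢ 0 mod 𝔭`,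
`picardTrace f 𝔭 - (#{x ∈ 𝓞 K ⧸ 𝔭 : f̄(x) = 0} - 1) ∈ (1 - ζ)`. Immediate from
`Literature.NumberTheory.GaloisRepresentations.picardTrace_sub_card_roots_sub_one_mem_span` and
`Literature.NumberTheory.GaloisRepresentations.isPrimitiveRoot_of_sq_add_self_add_one`.
[folklore; Ireland–Rosen 1982, Ch. 9 §3] -/
theorem branchPointCongruence_proof :
    Summit.Langlands.Langlands.Theses.PicardMuOrdinary.BranchPointCongruence := by
  unfold Summit.Langlands.Langlands.Theses.PicardMuOrdinary.BranchPointCongruence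
  intro ζ f 𝔭 hζ h3 hf
  classical
  exact picardTrace_sub_card_roots_sub_one_mem_span (isPrimitiveRoot_of_sq_add_self_add_one hζ) f h3 hf

end Summit.Langlands.Langlands.Theorems
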